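import Mathlib
import HarnessLib
import Summits.HubbardSuperconductivity.HubbardSuperconductivity.Theorems.KLProgrammeKLRegimeWickBubbleChannels
import Literature.MathematicalPhysics.QuantumLattice.GrassmannPolchinskiEquation

/-!
# Route `KLProgramme` — ENGINE child gen 5 (stmt-HubbardSuperconductivity-19918 `KLRegimeEngineV14`), stub `stub_engine_step_values`,
# conjunct (E2-v9): the second-order Wick term ORGANISED BY THE NUMBER OF LINES between the two vertices
# (E2-WICK-ROADMAP §5 (iii-d); cell gate-hubbard-kl, seat p1 g9; sequel to `…WickBubbleChannels`)

`klw_wickAction_succ_cross` (p484175) writes the step as `𝒲_{n+1} = 𝒲_n − ½·dblFold((e^{Δ_×(g)} − 1)(e^{Δ_×(D)}(𝒲_n⁰𝒲_n¹))) + e^{Δ_D}R₃`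
(`g = g_{n+1}`, `D = D_{n+1}`, `D_n = D + g`).  Since the cross Laplacians are additive in the covariance and their exponentials compose,
`(e^{Δ_×(g)} − 1)e^{Δ_×(D)} = e^{Δ_×(D_n)} − e^{Δ_×(D_{n+1})}` (§1, `gaussConv_cross_sub_one_apply`), and by the uniform nilpotency of the fermionic
Laplacian (`gaussConv_eq_sum_range`, GrassmannPolchinskiEquation) this is the FIXED finite sum
`Σ_{j < N} (j!)⁻¹·(Δ_×(D_n)^j − Δ_×(D_{n+1})^j)`, `N = |Γ×Fin 2| + 2` (§1, `gaussConv_sub_gaussConv_eq_sum_pow`): the `j`-th term collects the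
two-vertex graphs with EXACTLY `j` lines between the copies, line `j`-tuples from `D_n^{⊗j} − D_{n+1}^{⊗j}` (at least one slice line).  Model
readings (§2): **`klw_wickAction_succ_lines`** (the step with the line-number sum), **`klw_wickPairAmplitude_succ_lines`** (the pair amplitude:
`𝒞^W_{n+1} − 𝒞^W_n = −½·Σ_{j<N} (j!)⁻¹·𝒱₄[dblFold((Δ_×(D_n)^j − Δ_×(D_{n+1})^j)(𝒲_n⁰𝒲_n¹))](Z) + 𝒱₄[e^{Δ_D}R₃](Z)`), and the `j = 2` term BY NAME:
**`klw_wickPairAmplitude_succ_twoLine_term`** — its vertex function is `½ ×` the difference of the three-channel identities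
`vertexFn_dblFold_bubble_pairLabels` (p503245) at the diagonal line pairs `(D_n,D_n)` and `(D_{n+1},D_{n+1})` (`klw_rung_pairs_vertexFn_pairLabels`);
`j = 1` are the one-line graphs (external-leg dressing by the Wick two-point kernel), `j ≥ 3` the multi-line graphs (E.5 gain).

Proved; no definitions; exact identities; nothing about sizes is asserted.
-/

noncomputable section

namespace Summit.HubbardSuperconductivity.HubbardSuperconductivity.Theorems.KLRegimeWick

set_option linter.dupNamespace false -- summit = problem name (single-conjunct summit), D-0017

open Literature.MathematicalPhysics.QuantumLattice GrassmannAlgebra Finset Matrix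
open Literature.Probability.LatticeModels
open Summit.HubbardSuperconductivity.HubbardSuperconductivity.Theorems.TwoPointAssembly
open Summit.HubbardSuperconductivity.HubbardSuperconductivity.Theorems.KLProgrammeLegKernels
open Summit.HubbardSuperconductivity.HubbardSuperconductivity.Theorems.KLRegimeSplit
open scoped Nat

/-! ## §1 (generic) `(e^{Δ_×(g)} − 1)e^{Δ_×(D)} = e^{Δ_×(D+g)} − e^{Δ_×(D)} = Σ_j (j!)⁻¹(Δ_×(D+g)^j − Δ_×(D)^j)` -/

section Generic

variable (R : Type*) [CommRing R] [Algebra ℚ R] {Γ : Type*} [Fintype Γ] [DecidableEq Γ]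

omit [DecidableEq Γ] in
/-- **`(e^{Δ_×(g)} − 1)(e^{Δ_×(D)} P) = e^{Δ_×(D+g)} P − e^{Δ_×(D)} P`** (additivity of `crossCov`, composition of the exponentials). -/
theorem gaussConv_cross_sub_one_apply (g D : Matrix Γ Γ R) (P : GrassmannAlgebra R (Γ × Fin 2)) :
    (gaussConv R (crossCov R g) - 1) (gaussConv R (crossCov R D) P) =
      gaussConv R (crossCov R (D + g)) P - gaussConv R (crossCov R D) P := by
  rw [LinearMap.sub_apply, Module.End.one_apply, crossCov_add, add_comm, gaussConv_add_apply]

omit [DecidableEq Γ] in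
/-- **Organisation by the number of lines**: `e^{Δ_C} P − e^{Δ_{C′}} P = Σ_{j < |Γ|+2} (j!)⁻¹·(Δ_C^j P − Δ_{C′}^j P)` (uniform nilpotency). -/
theorem gaussConv_sub_gaussConv_eq_sum_pow {Γ' : Type*} [Fintype Γ'] (C C' : Matrix Γ' Γ' R) (P : GrassmannAlgebra R Γ') :
    gaussConv R C P - gaussConv R C' P =
      ∑ j ∈ Finset.range (Fintype.card Γ' + 2), ((j ! : ℚ)⁻¹) • ((grassmannLaplacian R C ^ j) P - (grassmannLaplacian R C' ^ j) P) := by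
  rw [gaussConv_eq_sum_range R C, gaussConv_eq_sum_range R C', LinearMap.sum_apply, LinearMap.sum_apply, ← Finset.sum_sub_distrib]
  refine Finset.sum_congr rfl fun j _ => ?_
  rw [LinearMap.smul_apply, LinearMap.smul_apply, smul_sub]

end Generic

/-! ## §2 (model) the step and the pair amplitude by line number; the two-line term by name -/

section Model

variable (L M : ℕ) [NeZero L] [NeZero M] (β U μ : ℝ) (K : TrigPolyC4v)

omit [NeZero M] in
/-- **`klw_wickAction_succ_lines`** — the step with the second-order term organised by line number:
`𝒲_{n+1} = 𝒲_n − ½·Σ_{j<N} (j!)⁻¹·dblFold((Δ_×(D_n)^j − Δ_×(D_{n+1})^j)(𝒲_n⁰𝒲_n¹)) + e^{Δ_{D_{n+1}}}R₃`, `N = |HubbardFieldIdx × Fin 2| + 2`. -/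
theorem klw_wickAction_succ_lines (n : ℕ) (hZ : klStepPartitionFn L M β U μ K n ≠ 0) :
    klWickAction L M β U μ K (n + 1) =
      klWickAction L M β U μ K n -
        (2 : ℂ)⁻¹ • dblFold ℂ (∑ j ∈ Finset.range (Fintype.card (HubbardFieldIdx L M × Fin 2) + 2), ((j ! : ℚ)⁻¹) •
          ((grassmannLaplacian ℂ (crossCov ℂ (klSoftCov L M β μ K n)) ^ j)
              (dblCopy ℂ 0 (klWickAction L M β U μ K n) * dblCopy ℂ 1 (klWickAction L M β U μ K n)) -
            (grassmannLaplacian ℂ (crossCov ℂ (klSoftCov L M β μ K (n + 1))) ^ j)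
              (dblCopy ℂ 0 (klWickAction L M β U μ K n) * dblCopy ℂ 1 (klWickAction L M β U μ K n)))) +
        gaussConv ℂ (klSoftCov L M β μ K (n + 1))
          (effAction ℂ (klSliceCov L M β μ K (n + 1)) (klEffectiveAction L M β U μ K klE0 n) -
              gaussConv ℂ (klSliceCov L M β μ K (n + 1)) (klEffectiveAction L M β U μ K klE0 n) +
            (2 : ℂ)⁻¹ • (gaussConv ℂ (klSliceCov L M β μ K (n + 1))
                (klEffectiveAction L M β U μ K klE0 n * klEffectiveAction L M β U μ K klE0 n) -
              gaussConv ℂ (klSliceCov L M β μ K (n + 1)) (klEffectiveAction L M β U μ K klE0 n) *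
                gaussConv ℂ (klSliceCov L M β μ K (n + 1)) (klEffectiveAction L M β U μ K klE0 n))) := by
  rw [klw_wickAction_succ_cross L M β U μ K n hZ, gaussConv_cross_sub_one_apply, ← klw_softCov_eq_succ_add_slice L M β μ K n,
    gaussConv_sub_gaussConv_eq_sum_pow]

omit [NeZero L] [NeZero M] in
/-- Vertex functions of a `ℚ`-scalar multiple. -/
theorem klw_vertexFn_ratSmul (q : ℚ) (G : HubbardGrassmann L M) (m : ℕ) (X : Fin m → HubbardFieldIdx L M) :
    vertexFn L M β (q • G) m X = (q : ℂ) * vertexFn L M β G m X := by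
  rw [show q • G = (q : ℂ) • G from (Rat.cast_smul_eq_qsmul ℂ q G).symm]
  simp only [vertexFn, kernel_smul]
  ring

omit [NeZero L] [NeZero M] in
/-- Vertex functions of a finite sum. -/
theorem klw_vertexFn_finset_sum {ι : Type*} (s : Finset ι) (G : ι → HubbardGrassmann L M) (m : ℕ) (X : Fin m → HubbardFieldIdx L M) :
    vertexFn L M β (∑ i ∈ s, G i) m X = ∑ i ∈ s, vertexFn L M β (G i) m X := by
  classical
  induction s using Finset.induction_on with
  | empty => simp
  | insert j s hj ih => rw [Finset.sum_insert hj, Finset.sum_insert hj, vertexFn_add, ih]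

/-- **`klw_wickPairAmplitude_succ_lines`** — the Wick pair amplitude increment by line number:
`𝒞^W_{n+1}(Q;k,k′) − 𝒞^W_n(Q;k,k′) = −½·Σ_{j<N} (j!)⁻¹·𝒱₄[dblFold((Δ_×(D_n)^j − Δ_×(D_{n+1})^j)(𝒲_n⁰𝒲_n¹))](Z) + 𝒱₄[e^{Δ_{D_{n+1}}}R₃](Z)`
at the pair labels `Z = (k′↑+, Q−k′↓+, Q−k↓−, k↑−)`. -/
theorem klw_wickPairAmplitude_succ_lines (n : ℕ) (hZ : klStepPartitionFn L M β U μ K n ≠ 0) (Q k k' : TorusSite 2 L) :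
    klWickPairAmplitude L M β U μ K (n + 1) Q k k' - klWickPairAmplitude L M β U μ K n Q k k' =
      -((2 : ℂ)⁻¹ * ∑ j ∈ Finset.range (Fintype.card (HubbardFieldIdx L M × Fin 2) + 2), ((j ! : ℚ)⁻¹ : ℂ) *
          vertexFn L M β (dblFold ℂ
            ((grassmannLaplacian ℂ (crossCov ℂ (klSoftCov L M β μ K n)) ^ j)
                (dblCopy ℂ 0 (klWickAction L M β U μ K n) * dblCopy ℂ 1 (klWickAction L M β U μ K n)) -
              (grassmannLaplacian ℂ (crossCov ℂ (klSoftCov L M β μ K (n + 1))) ^ j)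
                (dblCopy ℂ 0 (klWickAction L M β U μ K n) * dblCopy ℂ 1 (klWickAction L M β U μ K n)))) 4
            ![(((omega0 M, k'), 0), 0), ((((omega0 M).rev, Q - k'), 1), 0), ((((omega0 M).rev, Q - k), 1), 1), (((omega0 M, k), 0), 1)]) +
      vertexFn L M β (gaussConv ℂ (klSoftCov L M β μ K (n + 1))
          (effAction ℂ (klSliceCov L M β μ K (n + 1)) (klEffectiveAction L M β U μ K klE0 n) -
              gaussConv ℂ (klSliceCov L M β μ K (n + 1)) (klEffectiveAction L M β U μ K klE0 n) +
            (2 : ℂ)⁻¹ • (gaussConv ℂ (klSliceCov L M β μ K (n + 1))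
                (klEffectiveAction L M β U μ K klE0 n * klEffectiveAction L M β U μ K klE0 n) -
              gaussConv ℂ (klSliceCov L M β μ K (n + 1)) (klEffectiveAction L M β U μ K klE0 n) *
                gaussConv ℂ (klSliceCov L M β μ K (n + 1)) (klEffectiveAction L M β U μ K klE0 n)))) 4
        ![(((omega0 M, k'), 0), 0), ((((omega0 M).rev, Q - k'), 1), 0), ((((omega0 M).rev, Q - k), 1), 1), (((omega0 M, k), 0), 1)] := by
  have hsmul : ∀ (c : ℂ) (G : HubbardGrassmann L M) (X : Fin 4 → HubbardFieldIdx L M),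
      vertexFn L M β (c • G) 4 X = c * vertexFn L M β G 4 X := by
    intro c G X
    simp only [vertexFn, kernel_smul]
    ring
  rw [klWickPairAmplitude, klWickPairAmplitude, klw_wickAction_succ_lines L M β U μ K n hZ, vertexFn_add, klw_vertexFn_sub, hsmul, map_sum,
    klw_vertexFn_finset_sum]
  simp only [← Rat.cast_smul_eq_qsmul ℂ, map_smul, hsmul, Finset.mul_sum, Rat.cast_inv, Rat.cast_natCast]
  ring

omit [NeZero M] in
/-- **The `j`-th term as a difference of pure terms**: `𝒱ₘ[dblFold((Δ_×(C)^j) P − (Δ_×(C′)^j) P)] = 𝒱ₘ[dblFold((Δ_×(C)^j) P)] − 𝒱ₘ[dblFold((Δ_×(C′)^j) P)]`;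
for `j = 2` and `(C, C′) = (D_n, D_{n+1})` at the pair labels the two terms are the three-channel identities `vertexFn_dblFold_bubble_pairLabels`
(p503245) at the diagonal line pairs `(D_n, D_n)` / `(D_{n+1}, D_{n+1})` (`contr_klSoftCov_eq_diagContr … n` / `… (n+1)`, `sq`, `Module.End.mul_apply`) —
so the two-line share of `𝒞^W_{n+1} − 𝒞^W_n` is `−¼·[2(βL²)⁻³(PP + PHd − PHx − 2·S62)]_{D_n}^{D_{n+1}}`, whose particle–particle part is `−(K·diag z·K)`
with the FULL rung weight `z(x) = (βL²)⁻³(λ_{D_n}(x) − λ_{D_{n+1}}(x))/… ` (line pairs `g⊗g + g⊗D + D⊗g`, `klw_rung_pairs`). -/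
theorem klw_vertexFn_dblFold_pow_sub (C C' : Matrix (HubbardFieldIdx L M) (HubbardFieldIdx L M) ℂ)
    (P : GrassmannAlgebra ℂ (HubbardFieldIdx L M × Fin 2)) (j m : ℕ) (Z : Fin m → HubbardFieldIdx L M) :
    vertexFn L M β (dblFold ℂ ((grassmannLaplacian ℂ (crossCov ℂ C) ^ j) P - (grassmannLaplacian ℂ (crossCov ℂ C') ^ j) P)) m Z =
      vertexFn L M β (dblFold ℂ ((grassmannLaplacian ℂ (crossCov ℂ C) ^ j) P)) m Z -
        vertexFn L M β (dblFold ℂ ((grassmannLaplacian ℂ (crossCov ℂ C') ^ j) P)) m Z := by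
  rw [map_sub, klw_vertexFn_sub]

omit [NeZero M] in
/-- The square of a cross Laplacian applied: `(Δ_×(C)^2) P = Δ_×(C)(Δ_×(C) P)` (the form `vertexFn_dblFold_bubble_pairLabels` reads). -/
theorem klw_crossLaplacian_sq_apply (C : Matrix (HubbardFieldIdx L M) (HubbardFieldIdx L M) ℂ) (P : GrassmannAlgebra ℂ (HubbardFieldIdx L M × Fin 2)) :
    (grassmannLaplacian ℂ (crossCov ℂ C) ^ 2) P = grassmannLaplacian ℂ (crossCov ℂ C) (grassmannLaplacian ℂ (crossCov ℂ C) P) := by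
  rw [sq, Module.End.mul_apply]

/-- **`klw_wickPairAmplitude_succ_twoLine_term`** — the `j = 2` (two-line) term of `klw_wickPairAmplitude_succ_lines` in closed form: with
`d_m(p) = (1 − χ_{Λ_m}(p))·βL²·ĝ_K(p)` the soft line values (`contr_klSoftCov_eq_diagContr`),
`𝒱₄[dblFold((Δ_×(D_n)²)(𝒲⁰𝒲¹) − (Δ_×(D_{n+1})²)(𝒲⁰𝒲¹))](Z) = F_n − F_{n+1}`, `F_m` := the right-hand side of `vertexFn_dblFold_bubble_pairLabels` at
`ℓ₁ = ℓ₂ = d_m` (so `λ = 2·d_m(p)d_m(p̄)` etc.). -/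
theorem klw_wickPairAmplitude_succ_twoLine_term (hβ : β ≠ 0) (n : ℕ) (Q k k' : TorusSite 2 L) :
    vertexFn L M β (dblFold ℂ
        ((grassmannLaplacian ℂ (crossCov ℂ (klSoftCov L M β μ K n)) ^ 2)
            (dblCopy ℂ 0 (klWickAction L M β U μ K n) * dblCopy ℂ 1 (klWickAction L M β U μ K n)) -
          (grassmannLaplacian ℂ (crossCov ℂ (klSoftCov L M β μ K (n + 1))) ^ 2)
            (dblCopy ℂ 0 (klWickAction L M β U μ K n) * dblCopy ℂ 1 (klWickAction L M β U μ K n)))) 4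
        ![(((omega0 M, k'), 0), 0), ((((omega0 M).rev, Q - k'), 1), 0), ((((omega0 M).rev, Q - k), 1), 1), (((omega0 M, k), 0), 1)] =
      (2 * ((((β * (L : ℝ) ^ 2 : ℝ) : ℂ)) ^ 3)⁻¹ *
        ((∑ x : TorusSite 2 L × MatsubaraIdx M,
            ((((1 - hubbardCutoffWeightCT L M β μ K (klScale klE0 n) (x.2, x.1) : ℝ) : ℂ) *
                  (((β * (L : ℝ) ^ 2 : ℝ) : ℂ) * propCT L M β μ K (x.2, x.1))) *
                (((1 - hubbardCutoffWeightCT L M β μ K (klScale klE0 n) (x.2.rev, Q - x.1) : ℝ) : ℂ) *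
                  (((β * (L : ℝ) ^ 2 : ℝ) : ℂ) * propCT L M β μ K (x.2.rev, Q - x.1))) +
              (((1 - hubbardCutoffWeightCT L M β μ K (klScale klE0 n) (x.2, x.1) : ℝ) : ℂ) *
                  (((β * (L : ℝ) ^ 2 : ℝ) : ℂ) * propCT L M β μ K (x.2, x.1))) *
                (((1 - hubbardCutoffWeightCT L M β μ K (klScale klE0 n) (x.2.rev, Q - x.1) : ℝ) : ℂ) *
                  (((β * (L : ℝ) ^ 2 : ℝ) : ℂ) * propCT L M β μ K (x.2.rev, Q - x.1)))) *
              (klWickPairKernel L M β U μ K n Q (k, omega0 M) x * klWickPairKernel L M β U μ K n Q x (k', omega0 M))) +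
          (∑ p : FreqMomentum L M, ∑ σ : Fin 2,
            ((((1 - hubbardCutoffWeightCT L M β μ K (klScale klE0 n) p : ℝ) : ℂ) * (((β * (L : ℝ) ^ 2 : ℝ) : ℂ) * propCT L M β μ K p)) *
                (((1 - hubbardCutoffWeightCT L M β μ K (klScale klE0 n) (p.1, p.2 + k - k') : ℝ) : ℂ) *
                  (((β * (L : ℝ) ^ 2 : ℝ) : ℂ) * propCT L M β μ K (p.1, p.2 + k - k'))) +
              (((1 - hubbardCutoffWeightCT L M β μ K (klScale klE0 n) p : ℝ) : ℂ) * (((β * (L : ℝ) ^ 2 : ℝ) : ℂ) * propCT L M β μ K p)) *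
                (((1 - hubbardCutoffWeightCT L M β μ K (klScale klE0 n) (p.1, p.2 + k - k') : ℝ) : ℂ) *
                  (((β * (L : ℝ) ^ 2 : ℝ) : ℂ) * propCT L M β μ K (p.1, p.2 + k - k')))) *
              (vertexFn L M β (klWickAction L M β U μ K n) 4
                  ![((p, σ), 1), (((p.1, p.2 + k - k'), σ), 0), (((omega0 M, k'), 0), 0), (((omega0 M, k), 0), 1)] *
                vertexFn L M β (klWickAction L M β U μ K n) 4
                  ![((p, σ), 0), (((p.1, p.2 + k - k'), σ), 1), ((((omega0 M).rev, Q - k'), 1), 0), ((((omega0 M).rev, Q - k), 1), 1)])) -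
          (∑ p : FreqMomentum L M, ∑ p' : FreqMomentum L M,
            if matsubaraInt M p'.1 + 1 = matsubaraInt M p.1 ∧ p'.2 = p.2 + Q - k - k' then
              ((((1 - hubbardCutoffWeightCT L M β μ K (klScale klE0 n) p : ℝ) : ℂ) * (((β * (L : ℝ) ^ 2 : ℝ) : ℂ) * propCT L M β μ K p)) *
                (((1 - hubbardCutoffWeightCT L M β μ K (klScale klE0 n) p' : ℝ) : ℂ) * (((β * (L : ℝ) ^ 2 : ℝ) : ℂ) * propCT L M β μ K p')) +
              (((1 - hubbardCutoffWeightCT L M β μ K (klScale klE0 n) p : ℝ) : ℂ) * (((β * (L : ℝ) ^ 2 : ℝ) : ℂ) * propCT L M β μ K p)) *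
                (((1 - hubbardCutoffWeightCT L M β μ K (klScale klE0 n) p' : ℝ) : ℂ) * (((β * (L : ℝ) ^ 2 : ℝ) : ℂ) * propCT L M β μ K p'))) *
                (vertexFn L M β (klWickAction L M β U μ K n) 4
                    ![((p, 0), 1), ((p', 1), 0), (((omega0 M, k'), 0), 0), ((((omega0 M).rev, Q - k), 1), 1)] *
                  vertexFn L M β (klWickAction L M β U μ K n) 4
                    ![((p, 0), 0), ((p', 1), 1), ((((omega0 M).rev, Q - k'), 1), 0), (((omega0 M, k), 0), 1)])
            else 0) -
          2 * ∑ p : FreqMomentum L M, ∑ σ : Fin 2,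
            ((((1 - hubbardCutoffWeightCT L M β μ K (klScale klE0 n) p : ℝ) : ℂ) * (((β * (L : ℝ) ^ 2 : ℝ) : ℂ) * propCT L M β μ K p)) *
              (((1 - hubbardCutoffWeightCT L M β μ K (klScale klE0 n) p : ℝ) : ℂ) * (((β * (L : ℝ) ^ 2 : ℝ) : ℂ) * propCT L M β μ K p))) *
            (vertexFn L M β (klWickAction L M β U μ K n) 6
                ![((p, σ), 0), ((p, σ), 1), (((omega0 M, k'), 0), 0), ((((omega0 M).rev, Q - k'), 1), 0), ((((omega0 M).rev, Q - k), 1), 1),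
                  (((omega0 M, k), 0), 1)] *
              klWickSelfEnergy L M β U μ K n p σ))) -
      2 * ((((β * (L : ℝ) ^ 2 : ℝ) : ℂ)) ^ 3)⁻¹ *
        ((∑ x : TorusSite 2 L × MatsubaraIdx M,
            ((((1 - hubbardCutoffWeightCT L M β μ K (klScale klE0 (n + 1)) (x.2, x.1) : ℝ) : ℂ) *
                  (((β * (L : ℝ) ^ 2 : ℝ) : ℂ) * propCT L M β μ K (x.2, x.1))) *
                (((1 - hubbardCutoffWeightCT L M β μ K (klScale klE0 (n + 1)) (x.2.rev, Q - x.1) : ℝ) : ℂ) *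
                  (((β * (L : ℝ) ^ 2 : ℝ) : ℂ) * propCT L M β μ K (x.2.rev, Q - x.1))) +
              (((1 - hubbardCutoffWeightCT L M β μ K (klScale klE0 (n + 1)) (x.2, x.1) : ℝ) : ℂ) *
                  (((β * (L : ℝ) ^ 2 : ℝ) : ℂ) * propCT L M β μ K (x.2, x.1))) *
                (((1 - hubbardCutoffWeightCT L M β μ K (klScale klE0 (n + 1)) (x.2.rev, Q - x.1) : ℝ) : ℂ) *
                  (((β * (L : ℝ) ^ 2 : ℝ) : ℂ) * propCT L M β μ K (x.2.rev, Q - x.1)))) *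
              (klWickPairKernel L M β U μ K n Q (k, omega0 M) x * klWickPairKernel L M β U μ K n Q x (k', omega0 M))) +
          (∑ p : FreqMomentum L M, ∑ σ : Fin 2,
            ((((1 - hubbardCutoffWeightCT L M β μ K (klScale klE0 (n + 1)) p : ℝ) : ℂ) * (((β * (L : ℝ) ^ 2 : ℝ) : ℂ) * propCT L M β μ K p)) *
                (((1 - hubbardCutoffWeightCT L M β μ K (klScale klE0 (n + 1)) (p.1, p.2 + k - k') : ℝ) : ℂ) *
                  (((β * (L : ℝ) ^ 2 : ℝ) : ℂ) * propCT L M β μ K (p.1, p.2 + k - k'))) +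
              (((1 - hubbardCutoffWeightCT L M β μ K (klScale klE0 (n + 1)) p : ℝ) : ℂ) * (((β * (L : ℝ) ^ 2 : ℝ) : ℂ) * propCT L M β μ K p)) *
                (((1 - hubbardCutoffWeightCT L M β μ K (klScale klE0 (n + 1)) (p.1, p.2 + k - k') : ℝ) : ℂ) *
                  (((β * (L : ℝ) ^ 2 : ℝ) : ℂ) * propCT L M β μ K (p.1, p.2 + k - k')))) *
              (vertexFn L M β (klWickAction L M β U μ K n) 4
                  ![((p, σ), 1), (((p.1, p.2 + k - k'), σ), 0), (((omega0 M, k'), 0), 0), (((omega0 M, k), 0), 1)] *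
                vertexFn L M β (klWickAction L M β U μ K n) 4
                  ![((p, σ), 0), (((p.1, p.2 + k - k'), σ), 1), ((((omega0 M).rev, Q - k'), 1), 0), ((((omega0 M).rev, Q - k), 1), 1)])) -
          (∑ p : FreqMomentum L M, ∑ p' : FreqMomentum L M,
            if matsubaraInt M p'.1 + 1 = matsubaraInt M p.1 ∧ p'.2 = p.2 + Q - k - k' then
              ((((1 - hubbardCutoffWeightCT L M β μ K (klScale klE0 (n + 1)) p : ℝ) : ℂ) * (((β * (L : ℝ) ^ 2 : ℝ) : ℂ) * propCT L M β μ K p)) *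
                (((1 - hubbardCutoffWeightCT L M β μ K (klScale klE0 (n + 1)) p' : ℝ) : ℂ) * (((β * (L : ℝ) ^ 2 : ℝ) : ℂ) * propCT L M β μ K p')) +
              (((1 - hubbardCutoffWeightCT L M β μ K (klScale klE0 (n + 1)) p : ℝ) : ℂ) * (((β * (L : ℝ) ^ 2 : ℝ) : ℂ) * propCT L M β μ K p)) *
                (((1 - hubbardCutoffWeightCT L M β μ K (klScale klE0 (n + 1)) p' : ℝ) : ℂ) * (((β * (L : ℝ) ^ 2 : ℝ) : ℂ) * propCT L M β μ K p'))) *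
                (vertexFn L M β (klWickAction L M β U μ K n) 4
                    ![((p, 0), 1), ((p', 1), 0), (((omega0 M, k'), 0), 0), ((((omega0 M).rev, Q - k), 1), 1)] *
                  vertexFn L M β (klWickAction L M β U μ K n) 4
                    ![((p, 0), 0), ((p', 1), 1), ((((omega0 M).rev, Q - k'), 1), 0), (((omega0 M, k), 0), 1)])
            else 0) -
          2 * ∑ p : FreqMomentum L M, ∑ σ : Fin 2,
            ((((1 - hubbardCutoffWeightCT L M β μ K (klScale klE0 (n + 1)) p : ℝ) : ℂ) * (((β * (L : ℝ) ^ 2 : ℝ) : ℂ) * propCT L M β μ K p)) *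
              (((1 - hubbardCutoffWeightCT L M β μ K (klScale klE0 (n + 1)) p : ℝ) : ℂ) * (((β * (L : ℝ) ^ 2 : ℝ) : ℂ) * propCT L M β μ K p))) *
            (vertexFn L M β (klWickAction L M β U μ K n) 6
                ![((p, σ), 0), ((p, σ), 1), (((omega0 M, k'), 0), 0), ((((omega0 M).rev, Q - k'), 1), 0), ((((omega0 M).rev, Q - k), 1), 1),
                  (((omega0 M, k), 0), 1)] *
              klWickSelfEnergy L M β U μ K n p σ)) := by
  rw [klw_vertexFn_dblFold_pow_sub, klw_crossLaplacian_sq_apply, klw_crossLaplacian_sq_apply,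
    vertexFn_dblFold_bubble_pairLabels β U μ K hβ (contr_klSoftCov_eq_diagContr hβ μ K n) (contr_klSoftCov_eq_diagContr hβ μ K n) n Q k k',
    vertexFn_dblFold_bubble_pairLabels β U μ K hβ (contr_klSoftCov_eq_diagContr hβ μ K (n + 1)) (contr_klSoftCov_eq_diagContr hβ μ K (n + 1))
      n Q k k']

end Model

end Summit.HubbardSuperconductivity.HubbardSuperconductivity.Theorems.KLRegimeWick

end
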